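import Mathlib
import Summits.ValiantsHypothesis.ValiantsHypothesis.Theorems.LiouvilleSarnakLiouvilleCutRankCertifiedCutPoints
import Summits.ValiantsHypothesis.ValiantsHypothesis.Theorems.LiouvilleSarnakLiouvilleCutRankNoAdjacentRows
import Summits.ValiantsHypothesis.ValiantsHypothesis.Theorems.LiouvilleSarnakLiouvilleCutRankCutTranspose
import Literature.Computability.AlgebraicComplexity.BooleanGadgets
import HarnessLib

/-!
# Route LiouvilleSarnak — crux `LiouvilleCutRank` (stmt-ValiantsHypothesis-14775):
# LOCAL shift certificates — an isolated-letter WINDOW anywhere in the cut word bounds the rank from below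

`…ShiftCertificates.card_le_two_pow_rank_of_shift` (and its case `d = 1`, `…NoAdjacentRows`) assume that the WHOLE
cut word has no two row positions at distance `d`.  Inspection of that proof shows the hypothesis is only ever used
for two row positions lying strictly between two certified cut points.  This file records the resulting LOCAL form,
valid for an ARBITRARY cut `π` (any level, balanced as always by type) and an arbitrary window `[lo, hi)` of bit
positions:

* ★★ `card_le_two_pow_rank_of_shift_window` — let `d ≥ 1` with `λ(2^d + 1) = -1`; if no two ROW positions
  `j < j'` of `π` with `lo ≤ j`, `j' < hi` are at distance exactly `d`, then the number of row positions
  `j ∈ [lo, hi)` with `j + d < 2n` and no row position in `(j, j+d]` is at most `2^{rank M_π}` (prefix rows at the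
  cut points `j + 1`, pairwise certified by `c = 2^d + 1` exactly as in the global proof, which is the case
  `lo = 0`, `hi = 2n`).
* ★ `card_le_two_pow_rank_of_noAdjacentRows_window` — `d = 1`: a window `[lo, hi)` containing no factor `RR`
  gives `#{row positions j : lo ≤ j, j + 1 < hi} ≤ 2^{rank M_π}`, i.e. `rank ≥ log₂` of the number of (isolated)
  row letters inside ANY `RR`-free factor of the cut word — e.g. a Sturmian / `(C^{a_1} R C^{a_2} R …)` stretch of
  a word that elsewhere is arbitrary.
* ★ `card_le_two_pow_rank_of_shift_cols_window`, `card_le_two_pow_rank_of_noAdjacentCols_window` — the column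
  duals (letter swap transposes the cut matrix, `CutTranspose.rank_cutMatrix_swap`): a `CC`-free factor with `k + 1`
  column letters gives `rank ≥ log₂ k`.  Example of a word covered here and by no global class of the census:
  `(RRC)^m C^m` (balanced, `≍ n` letter changes, contains `RR` and `CC`, not periodic; its factor `(RRC)^m` is
  `CC`-free with `m` column letters, so `rank ≥ ⌊log₂ (m-1)⌋`).

Honest framing: a local repackaging of the certificate method with explicit rates; the residual class of the crux
(words all of whose long factors contain both `RR` and `CC` at every distance scale, e.g. the Thue–Morse cut word,
for which the certificate cliques stay bounded — census numerics of this hand) is untouched; `LiouvilleCutRank`,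
`DigitalBilinearLiouville`, `AlgebraicSarnak` stay OPEN; nothing bears on `VP ≠ VNP`.  No definitions.  The proof of
the main theorem is the tree's `…ShiftCertificates` proof (leafhand-2 g3) with the window bookkeeping threaded
through; adapted, not re-invented.
-/

set_option linter.dupNamespace false

noncomputable section

namespace Summit.ValiantsHypothesis.ValiantsHypothesis.Theorems.LiouvilleSarnakLiouvilleCutRank.ShiftCertificatesWindow

open ArithmeticFunction Finset

open Summit.ValiantsHypothesis.ValiantsHypothesis.Theorems.LiouvilleSarnakLiouvilleCutRank.CertifiedCutPoints
  (card_le_two_pow_rank_of_certified)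
open Literature.Computability.AlgebraicComplexity.BoolGadgets (ofBits_eq_sum)
open Summit.ValiantsHypothesis.ValiantsHypothesis.Theorems.LiouvilleSarnakLiouvilleCutRank.NoAdjacentRows
  (ofBits_split_min)
open Summit.ValiantsHypothesis.ValiantsHypothesis.Theorems.LiouvilleSarnakLiouvilleCutRank.CutTranspose
  (rank_cutMatrix_swap)

/-! ### §1 Windowed shift certificates (rows) -/

/-- ★★ **Local shift certificates.**  Let `d ≥ 1` with `λ(2^d + 1) = -1`, let `π` be a cut of the `2n` bit
positions and `[lo, hi)` a window such that no two ROW positions `j, j + d` satisfy `lo ≤ j` and `j + d < hi`.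
Then the number of row positions `j` with `lo ≤ j < hi`, `j + d < 2n` and no row position in `(j, j + d]` is at
most `2^{rank M_π}`.  (The global theorem `ShiftCertificates.card_le_two_pow_rank_of_shift` is `lo = 0, hi = 2n`.)
[this file; proof adapted from `…ShiftCertificates`] -/
theorem card_le_two_pow_rank_of_shift_window (n d lo hi : ℕ) (hd : 1 ≤ d) (hl : liouville (2 ^ d + 1) = -1)
    (π : Fin n ⊕ Fin n ≃ Fin (2 * n))
    (hRR : ∀ i i' : Fin n, lo ≤ (π (Sum.inl i) : ℕ) → (π (Sum.inl i') : ℕ) < hi →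
      (π (Sum.inl i') : ℕ) ≠ (π (Sum.inl i) : ℕ) + d) :
    ((Finset.univ : Finset (Fin n)).filter (fun i => lo ≤ (π (Sum.inl i) : ℕ) ∧ (π (Sum.inl i) : ℕ) < hi ∧
        (π (Sum.inl i) : ℕ) + d < 2 * n ∧
        ∀ i' : Fin n, ¬ ((π (Sum.inl i) : ℕ) < (π (Sum.inl i') : ℕ) ∧
          (π (Sum.inl i') : ℕ) ≤ (π (Sum.inl i) : ℕ) + d))).card ≤
      2 ^ (Matrix.of fun r c : Fin n → Bool =>
        (((liouville (Nat.ofBits (fun k : Fin (2 * n) => Sum.elim r c (π.symm k)) + 1) : ℤ) : ℂ))).rank := by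
  classical
  set S := (Finset.univ : Finset (Fin n)).filter (fun i => lo ≤ (π (Sum.inl i) : ℕ) ∧
      (π (Sum.inl i) : ℕ) < hi ∧ (π (Sum.inl i) : ℕ) + d < 2 * n ∧
        ∀ i' : Fin n, ¬ ((π (Sum.inl i) : ℕ) < (π (Sum.inl i') : ℕ) ∧
          (π (Sum.inl i') : ℕ) ≤ (π (Sum.inl i) : ℕ) + d)) with hS
  -- positions: a position with `isLeft = false` is a column position; `isLeft = true` is a row position
  have hcol : ∀ j : Fin (2 * n), (π.symm j).isLeft = false → ∃ i : Fin n, (π (Sum.inr i) : ℕ) = j := by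
    intro j h
    rcases hj : π.symm j with i | i
    · rw [hj] at h; simp at h
    · exact ⟨i, by rw [← hj, Equiv.apply_symm_apply]⟩
  have hrow : ∀ j : Fin (2 * n), (π.symm j).isLeft = true → ∃ i : Fin n, (π (Sum.inl i) : ℕ) = j := by
    intro j h
    rcases hj : π.symm j with i | i
    · exact ⟨i, by rw [← hj, Equiv.apply_symm_apply]⟩
    · rw [hj] at h; simp at h
  -- membership in `S`, unpacked
  have hmemS : ∀ i ∈ S, lo ≤ (π (Sum.inl i) : ℕ) ∧ (π (Sum.inl i) : ℕ) < hi ∧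
      (π (Sum.inl i) : ℕ) + d < 2 * n ∧
      ∀ i' : Fin n, ¬ ((π (Sum.inl i) : ℕ) < (π (Sum.inl i') : ℕ) ∧
        (π (Sum.inl i') : ℕ) ≤ (π (Sum.inl i) : ℕ) + d) := by
    intro i hi
    rw [hS, Finset.mem_filter] at hi
    exact hi.2
  -- for `i ∈ S`: the positions `(π(inl i), π(inl i) + d]` are not rows
  have hgap : ∀ i ∈ S, ∀ j : Fin (2 * n), (π (Sum.inl i) : ℕ) < j → (j : ℕ) ≤ (π (Sum.inl i) : ℕ) + d →
      (π.symm j).isLeft = false := by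
    intro i hi j h1 h2
    by_contra h
    rw [Bool.not_eq_false] at h
    obtain ⟨i', hi'⟩ := hrow j h
    exact (hmemS i hi).2.2.2 i' ⟨by omega, by omega⟩
  have key := card_le_two_pow_rank_of_certified n π (S.image fun i => (π (Sum.inl i) : ℕ) + 1)
    (fun p hp => by
      obtain ⟨i, -, rfl⟩ := Finset.mem_image.mp hp
      have := (π (Sum.inl i)).2; omega)
    (fun p hp p' hp' hpp' => by
      obtain ⟨i, hiS, rfl⟩ := Finset.mem_image.mp hp
      obtain ⟨i', hi'S, rfl⟩ := Finset.mem_image.mp hp'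
      -- abbreviations
      set p := (π (Sum.inl i) : ℕ) + 1 with hpdef
      set p' := (π (Sum.inl i') : ℕ) + 1 with hp'def
      have hidn : (π (Sum.inl i) : ℕ) + d < 2 * n := (hmemS i hiS).2.2.1
      have hilo : lo ≤ (π (Sum.inl i) : ℕ) := (hmemS i hiS).1
      have hi'hi : (π (Sum.inl i') : ℕ) < hi := (hmemS i' hi'S).2.1
      have hii' : p + d ≤ (π (Sum.inl i') : ℕ) := by
        have h1 : (π (Sum.inl i) : ℕ) < (π (Sum.inl i') : ℕ) := by omega
        have h2 := hgap i hiS (π (Sum.inl i')) h1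
        rw [Equiv.symm_apply_apply] at h2
        simp only [Sum.isLeft_inl] at h2
        by_contra h
        exact absurd (h2 (by omega)) (by simp)
      -- the bit function of the exponents `e = j - p - d` of row positions `j ∈ [p+d, p')`
      set G : ℕ → Bool := fun e => if h : p + d + e < 2 * n then
        decide (p + d + e < p') && (π.symm ⟨p + d + e, h⟩).isLeft else false with hGdef
      have hGN : ∀ e, 2 * n ≤ e → G e = false := fun e he => by
        rw [hGdef]; simp only; rw [dif_neg (by omega)]
      have hGlt : ∀ e, G e = true → p + d + e < 2 * n := by
        intro e he
        by_contra h
        rw [hGdef] at he; simp only at he; rw [dif_neg h] at he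
        exact Bool.false_ne_true he
      have hGp' : ∀ e, G e = true → p + d + e < p' := by
        intro e he
        have h := hGlt e he
        rw [hGdef] at he; simp only at he; rw [dif_pos h] at he
        simp only [Bool.and_eq_true, decide_eq_true_eq] at he
        exact he.1
      have hGleft : ∀ e (he : G e = true), (π.symm ⟨p + d + e, hGlt e he⟩).isLeft = true := by
        intro e he
        have h := hGlt e he
        have he' := he
        rw [hGdef] at he'; simp only at he'; rw [dif_pos h] at he'
        simp only [Bool.and_eq_true, decide_eq_true_eq] at he'
        exact he'.2
      have hGintro : ∀ e (h : p + d + e < 2 * n), p + d + e < p' →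
          (π.symm ⟨p + d + e, h⟩).isLeft = true → G e = true := by
        intro e h h1 h2
        rw [hGdef]; simp only; rw [dif_pos h]
        simp only [Bool.and_eq_true, decide_eq_true_eq]
        exact ⟨h1, h2⟩
      -- `e₁ = π(inl i') - p - d` is an exponent
      have he₁ : G ((π (Sum.inl i') : ℕ) - p - d) = true := by
        have hlt : p + d + ((π (Sum.inl i') : ℕ) - p - d) < 2 * n := by have := (π (Sum.inl i')).2; omega
        refine hGintro _ hlt (by omega) ?_
        have hj : (⟨p + d + ((π (Sum.inl i') : ℕ) - p - d), hlt⟩ : Fin (2 * n)) = π (Sum.inl i') :=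
          Fin.ext (by simp only; omega)
        rw [hj, Equiv.symm_apply_apply]; rfl
      -- the least exponent
      have hex : ∃ e, G e = true := ⟨_, he₁⟩
      obtain ⟨e₀, hG0, hmin'⟩ : ∃ e₀, G e₀ = true ∧ ∀ e, e < e₀ → G e = false :=
        ⟨Nat.find hex, Nat.find_spec hex, fun e he => by
          have := Nat.find_min hex he; simpa using this⟩
      have h0N := hGlt e₀ hG0
      have h0p' := hGp' e₀ hG0
      -- the certificate `x`
      have hxsplit := ofBits_split_min (2 * n) G hGN e₀ hG0 hmin'
      have hx1 : 1 ≤ Nat.ofBits (fun e : Fin (2 * n) => G e) := by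
        rw [hxsplit]; have := Nat.one_le_two_pow (n := e₀); omega
      refine ⟨2 ^ d + 1, Nat.ofBits (fun e : Fin (2 * n) => G e), hl, hx1, ?_, ?_⟩
      · -- `x * 2^d = m`: reindex `e ↦ j = p + d + e`
        rw [Nat.add_sub_cancel]
        have hGne : ∀ e : Fin (2 * n), (G e).toNat * 2 ^ (e : ℕ) * 2 ^ d ≠ 0 → G e = true := by
          intro e hne
          by_contra h
          rw [Bool.not_eq_true] at h
          rw [h] at hne
          simp at hne
        rw [ofBits_eq_sum, Finset.sum_mul]
        refine Finset.sum_bij_ne_zero (fun e _ hne => (⟨p + d + (e : ℕ), hGlt e (hGne e hne)⟩ : Fin (2 * n)))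
          (fun e _ hne => Finset.mem_univ _) (fun e₁ _ _ e₂ _ _ h => by
            have := congrArg Fin.val h; exact Fin.ext (by simp only at this; omega)) ?_ ?_
        · -- surjectivity onto the support
          intro j _ hne
          have hc : p ≤ (j : ℕ) ∧ (j : ℕ) < p' ∧ (π.symm j).isLeft = true := by
            by_contra h; exact hne (if_neg h)
          have hjp : p + d ≤ (j : ℕ) := by
            by_contra h
            have := hgap i hiS j (by omega) (by omega)
            rw [hc.2.2] at this
            exact Bool.noConfusion this
          have hjlt : (j : ℕ) - p - d < 2 * n := by have := j.2; omega
          have hG : G ((j : ℕ) - p - d) = true := by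
            have hlt : p + d + ((j : ℕ) - p - d) < 2 * n := by have := j.2; omega
            refine hGintro _ hlt (by omega) ?_
            have hj : (⟨p + d + ((j : ℕ) - p - d), hlt⟩ : Fin (2 * n)) = j := Fin.ext (by simp only; omega)
            rw [hj]; exact hc.2.2
          refine ⟨⟨(j : ℕ) - p - d, hjlt⟩, Finset.mem_univ _, ?_, Fin.ext (by simp only; omega)⟩
          simp only [hG, Bool.toNat_true, one_mul]
          positivity
        · -- values agree
          intro e _ hne
          have hG := hGne e hne
          rw [if_pos ⟨by simp only; omega, by have := hGp' e hG; simp only; omega, hGleft e hG⟩]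
          simp only [hG, Bool.toNat_true, one_mul]
          rw [show p + d + (e : ℕ) - p = (e : ℕ) + d by omega, pow_add]
      · -- bits of `x - 1` sit at column positions `p + b`
        intro b hb
        have hxm1 : Nat.ofBits (fun e : Fin (2 * n) => G e) - 1 =
            2 ^ (e₀ + 1) * Nat.ofBits (fun e : Fin (2 * n) => G ((e : ℕ) + e₀ + 1)) + (2 ^ e₀ - 1) := by
          rw [hxsplit]; have := Nat.one_le_two_pow (n := e₀); omega
        rw [hxm1, Nat.testBit_two_pow_mul_add _ (by
            have := Nat.one_le_two_pow (n := e₀)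
            have := Nat.pow_lt_pow_right (by norm_num : 1 < 2) (Nat.lt_succ_self e₀)
            omega : 2 ^ e₀ - 1 < 2 ^ (e₀ + 1)),
          Nat.testBit_two_pow_sub_one, Nat.testBit_ofBits] at hb
        by_cases hb0 : b < e₀ + 1
        · -- low bits: `b < e₀`; position `p + b` precedes the first row position `p + d + e₀` after `p`
          rw [if_pos hb0, decide_eq_true_eq] at hb
          have hqn : p + b < 2 * n := by omega
          refine hcol ⟨p + b, hqn⟩ ?_
          by_cases hbd : b < d
          · exact hgap i hiS ⟨p + b, hqn⟩ (by simp only; omega) (by simp only; omega)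
          · by_contra hleft
            rw [Bool.not_eq_false] at hleft
            have hG' : G (b - d) = true := by
              have hlt : p + d + (b - d) < 2 * n := by omega
              refine hGintro _ hlt (by omega) ?_
              have hj : (⟨p + d + (b - d), hlt⟩ : Fin (2 * n)) = ⟨p + b, hqn⟩ := Fin.ext (by simp only; omega)
              rw [hj]; exact hleft
            rw [hmin' (b - d) (by omega)] at hG'
            exact Bool.false_ne_true hG'
        · -- high bits: `b > e₀` with `G b = true`; position `p + b = j - d` for the row position `j = p + d + b`,
          -- both strictly between the two cut points, hence inside the window `[lo, hi)`
          rw [if_neg hb0] at hb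
          by_cases hbN : b - (e₀ + 1) < 2 * n
          · rw [dif_pos hbN] at hb
            have hb' : G b = true := by rwa [show b - (e₀ + 1) + e₀ + 1 = b by omega] at hb
            have hblt := hGlt b hb'
            have hbp' := hGp' b hb'
            have hqn : p + b < 2 * n := by omega
            refine hcol ⟨p + b, hqn⟩ ?_
            by_contra hleft
            rw [Bool.not_eq_false] at hleft
            obtain ⟨i₁, hi₁⟩ := hrow ⟨p + b, hqn⟩ hleft
            obtain ⟨i₂, hi₂⟩ := hrow ⟨p + d + b, hblt⟩ (hGleft b hb')
            simp only at hi₁ hi₂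
            exact hRR i₁ i₂ (by omega) (by omega) (by omega)
          · rw [dif_neg hbN] at hb
            exact absurd hb Bool.false_ne_true)
  rwa [Finset.card_image_of_injOn (fun a _ b _ h => by
      have : (π (Sum.inl a) : ℕ) = (π (Sum.inl b) : ℕ) := by simpa using h
      exact Sum.inl_injective (π.injective (Fin.ext this)))] at key

/-- ★ **An `RR`-free window.**  If the window `[lo, hi)` of the cut word of `π` (`hi ≤ 2n`) contains no two
adjacent row positions, then the number of row positions `j` with `lo ≤ j` and `j + 1 < hi` is at most
`2^{rank M_π}`; i.e. `rank M_π ≥ log₂` of the number of row letters (but the last) of ANY `RR`-free factor.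
[this file] -/
theorem card_le_two_pow_rank_of_noAdjacentRows_window (n lo hi : ℕ) (hhi : hi ≤ 2 * n)
    (π : Fin n ⊕ Fin n ≃ Fin (2 * n))
    (hRR : ∀ i i' : Fin n, lo ≤ (π (Sum.inl i) : ℕ) → (π (Sum.inl i') : ℕ) < hi →
      (π (Sum.inl i') : ℕ) ≠ (π (Sum.inl i) : ℕ) + 1) :
    ((Finset.univ : Finset (Fin n)).filter (fun i => lo ≤ (π (Sum.inl i) : ℕ) ∧
        (π (Sum.inl i) : ℕ) + 1 < hi)).card ≤
      2 ^ (Matrix.of fun r c : Fin n → Bool =>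
        (((liouville (Nat.ofBits (fun k : Fin (2 * n) => Sum.elim r c (π.symm k)) + 1) : ℤ) : ℂ))).rank := by
  classical
  have h3 : liouville (2 ^ 1 + 1) = -1 := by
    rw [show (2 : ℕ) ^ 1 + 1 = 3 by norm_num, liouville_apply (by norm_num : (3 : ℕ) ≠ 0),
      cardFactors_apply_prime Nat.prime_three]
    norm_num
  refine le_trans (Finset.card_le_card fun i hi => ?_) (card_le_two_pow_rank_of_shift_window n 1 lo hi le_rfl h3 π hRR)
  simp only [Finset.mem_filter, Finset.mem_univ, true_and] at hi ⊢
  refine ⟨hi.1, by omega, by omega, fun i' h => ?_⟩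
  have heq : (π (Sum.inl i') : ℕ) = (π (Sum.inl i) : ℕ) + 1 := by omega
  exact hRR i i' hi.1 (by omega) heq

/-! ### §2 The column duals -/

/-- ★ **Local shift certificates for columns.**  `d ≥ 1`, `λ(2^d + 1) = -1`, no two COLUMN positions `j, j + d`
with `lo ≤ j`, `j + d < hi` ⟹ the number of column positions `j ∈ [lo, hi)` with `j + d < 2n` and no column position
in `(j, j + d]` is at most `2^{rank M_π}` (letter swap transposes the cut matrix). [this file] -/
theorem card_le_two_pow_rank_of_shift_cols_window (n d lo hi : ℕ) (hd : 1 ≤ d) (hl : liouville (2 ^ d + 1) = -1)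
    (π : Fin n ⊕ Fin n ≃ Fin (2 * n))
    (hCC : ∀ i i' : Fin n, lo ≤ (π (Sum.inr i) : ℕ) → (π (Sum.inr i') : ℕ) < hi →
      (π (Sum.inr i') : ℕ) ≠ (π (Sum.inr i) : ℕ) + d) :
    ((Finset.univ : Finset (Fin n)).filter (fun i => lo ≤ (π (Sum.inr i) : ℕ) ∧ (π (Sum.inr i) : ℕ) < hi ∧
        (π (Sum.inr i) : ℕ) + d < 2 * n ∧
        ∀ i' : Fin n, ¬ ((π (Sum.inr i) : ℕ) < (π (Sum.inr i') : ℕ) ∧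
          (π (Sum.inr i') : ℕ) ≤ (π (Sum.inr i) : ℕ) + d))).card ≤
      2 ^ (Matrix.of fun r c : Fin n → Bool =>
        (((liouville (Nat.ofBits (fun k : Fin (2 * n) => Sum.elim r c (π.symm k)) + 1) : ℤ) : ℂ))).rank := by
  have h := card_le_two_pow_rank_of_shift_window n d lo hi hd hl ((Equiv.sumComm (Fin n) (Fin n)).trans π)
    (by simpa using hCC)
  rw [rank_cutMatrix_swap] at h
  simpa using h

/-- ★ **A `CC`-free window.**  If the window `[lo, hi)` (`hi ≤ 2n`) contains no two adjacent column positions,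
then `#{column positions j : lo ≤ j, j + 1 < hi} ≤ 2^{rank M_π}` — e.g. the factor `(RRC)^m` of the balanced word
`(RRC)^m C^m` gives `m - 1 ≤ 2^{rank}`. [this file] -/
theorem card_le_two_pow_rank_of_noAdjacentCols_window (n lo hi : ℕ) (hhi : hi ≤ 2 * n)
    (π : Fin n ⊕ Fin n ≃ Fin (2 * n))
    (hCC : ∀ i i' : Fin n, lo ≤ (π (Sum.inr i) : ℕ) → (π (Sum.inr i') : ℕ) < hi →
      (π (Sum.inr i') : ℕ) ≠ (π (Sum.inr i) : ℕ) + 1) :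
    ((Finset.univ : Finset (Fin n)).filter (fun i => lo ≤ (π (Sum.inr i) : ℕ) ∧
        (π (Sum.inr i) : ℕ) + 1 < hi)).card ≤
      2 ^ (Matrix.of fun r c : Fin n → Bool =>
        (((liouville (Nat.ofBits (fun k : Fin (2 * n) => Sum.elim r c (π.symm k)) + 1) : ℤ) : ℂ))).rank := by
  have h := card_le_two_pow_rank_of_noAdjacentRows_window n lo hi hhi ((Equiv.sumComm (Fin n) (Fin n)).trans π)
    (by simpa using hCC)
  rw [rank_cutMatrix_swap] at h
  simpa using h

end Summit.ValiantsHypothesis.ValiantsHypothesis.Theorems.LiouvilleSarnakLiouvilleCutRank.ShiftCertificatesWindow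

end
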